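import Mathlib
import Summits.NavierStokesRegularity.NavierStokesRegularity.Theorems.TaoLadderRungTwoBreakOneShiftWindowStepEndOn
import HarnessLib

/-!
# The one-shift window system, LI: END-OF-STEP BOXES OVER A TIME INTERVAL — part XLVIII's sub-box end boxes with the point
# time `tD` replaced by a dyadic INTERVAL `TI ∋ t` (the powers `[TI]^j`), for the enclosure of the reference run at a
# non-dyadic time of the final step (the frame's flight-time centre `τc`, where (K3) reads the centre residual); the rough
# version for runs given only up to `τ' ≤ h` (part XLIV `RoughStepD.sound'`) (cell harvest/h2-tao-ladder, seat p2;
# rung1/KERNEL-CHEAP-REPLAY-SPEC.md §2 (STEP B/C: hull over X × T, point at τ̂); support for K1(1) = `NoSurvivingDSSOne`,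
# stmt-NavierStokesRegularity-20205)

MODEL lattice ODEs only (Tao 2016 §4 normal form on Tao's shift set `S`); nothing here is a statement about
the Navier–Stokes equations; no item is closed; no instance is evaluated here. Generic in `ι`, `κ`.

* `CentreStepD.endBoxOnI X TI c`, `CentreStepD.end_mem_onI` — every centre solution from `y₀ ∈ X ⊆ W` at every `t ∈ [0, h]`
  with `t ∈ TI`;
* `RoughStepD.endBoxROnI X TI c` (`± Ẑ₁`), `RoughStepD.end_mem_onI` — every rough realisation's run from `X` given on `[0, τ']`.
-/

-- the sub-problem namespace repeats the summit name by design (D-0017)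
set_option linter.dupNamespace false

namespace Summit.NavierStokesRegularity.NavierStokesRegularity.Theorems

namespace DSSOneShift

open Set Finset Metric Filter Topology TopologicalSpace
open Literature.Analysis.ODE
open Summit.NavierStokesRegularity.NavierStokesRegularity.Theorems.TaylorModelCert
open Summit.NavierStokesRegularity.NavierStokesRegularity.Theorems.TaylorModelReadout
open Summit.NavierStokesRegularity.NavierStokesRegularity.Theorems.CertificateGlueOn
open scoped ContDiff

namespace CentreStepD

variable (d : CentreStepD)

/-- **The end-of-step box from a sub-box `X` over a time interval `TI`**: `Σ_{j<K} TI^j ⊗ Φ_j(X)_c ⊕ TI^K ⊗ Φ_K(S)_c`.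
[cite: Moore1979, §8.1 eq. (8.10); NedialkovJacksonPryce2001, §3] -/
def endBoxOnI (X : Array IntervalD) (TI : IntervalD) (c : ℕ) : IntervalD :=
  IntervalD.addR d.prec
    (IntervalD.rangeSumR d.prec (fun j => IntervalD.mulR d.prec (IntervalD.powR d.prec TI j)
      (IntervalD.aget (IntervalD.lget (d.jets X) j) c)) d.K)
    (IntervalD.mulR d.prec (IntervalD.powR d.prec TI d.K) (IntervalD.aget (IntervalD.lget (d.jets d.S) d.K) c))

variable {ι : Type*} [Fintype ι] [DecidableEq ι] {κ : Type*} [Fintype κ]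

/-- **EVERY CENTRE SOLUTION FROM THE SUB-BOX IS IN THE INTERVAL-TIME END BOX** at every `t ∈ [0, h]` with `t ∈ TI`.
[cite: Moore1979, §8.1 eq. (8.10); NedialkovJacksonPryce2001, §3] -/
theorem end_mem_onI (T : κ → BTerm ι) (e : ι ≃ Fin d.n) (hSD : IsSQEnclosure (homQ T e) d.SD) (hc : d.check = true)
    {X : Array IntervalD} (hwfX : ∀ c < d.n, wfD (IntervalD.aget X c) = true) (hXW : boxSet (boxOf e X) ⊆ boxSet (boxOf e d.W))
    {y₀ : ι → ℝ} (hy₀ : y₀ ∈ boxSet (boxOf e X)) {z : ℝ → ι → ℝ} (hz0 : z 0 = y₀)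
    (hz : ∀ t ∈ Icc 0 d.hD.toReal, HasDerivWithinAt z (termField T (z t)) (Icc 0 d.hD.toReal) t)
    {TI : IntervalD} {t : ℝ} (ht : t ∈ Icc 0 d.hD.toReal) (htI : IntervalD.mem t TI) (i : ι) :
    IntervalD.mem (z t i) (d.endBoxOnI X TI (e i)) := by
  classical
  rw [check_eq] at hc
  obtain ⟨hK, hh, hcS, -⟩ := d.of_checkWith hc
  have hwfW : ∀ c < d.n, wfD (IntervalD.aget d.W c) = true := fun c hc => (hcS c hc).1
  have hwfS : ∀ c < d.n, wfD (IntervalD.aget d.S c) = true := fun c hc => wfD_of_wfsD (hcS c hc).2.1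
  have hf : ContDiff ℝ ∞ (termField T) := (contDiff_termField T).of_le le_top
  have hfOn : ContDiffOn ℝ ∞ (termField T) ((⊤ : Opens (ι → ℝ)) : Set (ι → ℝ)) := termField_contDiffOn T
  have ePhi : ∀ j, smoothTaylorMap (Ω := ⊤) hfOn j = tjet T j := fun j => rfl
  have hjetX : ∀ x ∈ boxSet (boxOf e X), ∀ j ≤ d.K, ∀ i,
      IntervalD.mem (tjet T j x i) (IntervalD.aget (IntervalD.lget (d.jets X) j) (e i)) := by
    intro x hx j hj i
    have hm : IntervalD.mem (tjet T j x (e.symm ⟨(e i : ℕ), (e i).isLt⟩)) (IntervalD.aget (IntervalD.lget (d.jets X) j) (e i)) :=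
      mem_tjet_of_jetLevelsA T e hSD d.prec d.K (d.size_ext X) (d.hboxMem_of_mem_boxOf e hwfX hx) hj (e i).isLt
    simpa using hm
  have hjetW : ∀ x ∈ boxSet (boxOf e d.W), ∀ j ≤ d.K, ∀ i,
      IntervalD.mem (tjet T j x i) (IntervalD.aget (IntervalD.lget (d.jets d.W) j) (e i)) := by
    intro x hx j hj i
    have hm : IntervalD.mem (tjet T j x (e.symm ⟨(e i : ℕ), (e i).isLt⟩)) (IntervalD.aget (IntervalD.lget (d.jets d.W) j) (e i)) :=
      mem_tjet_of_jetLevelsA T e hSD d.prec d.K (d.size_ext d.W) (d.hboxMem_of_mem_boxOf e hwfW hx) hj (e i).isLt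
    simpa using hm
  have hjetS : ∀ x ∈ boxSet (boxOf e d.S), ∀ j ≤ d.K, ∀ i,
      IntervalD.mem (tjet T j x i) (IntervalD.aget (IntervalD.lget (d.jets d.S) j) (e i)) := by
    intro x hx j hj i
    have hm : IntervalD.mem (tjet T j x (e.symm ⟨(e i : ℕ), (e i).isLt⟩)) (IntervalD.aget (IntervalD.lget (d.jets d.S) j) (e i)) :=
      mem_tjet_of_jetLevelsA T e hSD d.prec d.K (d.size_ext d.S) (d.hboxMem_of_mem_boxOf e hwfS hx) hj (e i).isLt
    simpa using hm
  set c : ι → ℝ := fun i => (IntervalD.aget (IntervalD.lget (d.jets d.S) d.K) (e i)).lo.toReal with hcdef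
  set dd : ι → ℝ := fun i => (IntervalD.aget (IntervalD.lget (d.jets d.S) d.K) (e i)).hi.toReal with hdddef
  have hKS : MapsTo (smoothTaylorMap (Ω := ⊤) hfOn d.K) (boxSet (boxOf e d.S)) (Icc c dd) := by
    intro x hx; rw [ePhi]
    exact ⟨fun i => (hjetS x hx d.K le_rfl i).1, fun i => (hjetS x hx d.K le_rfl i).2⟩
  have hcd : c ≤ dd := by
    have hz := hKS (left_mem_Icc.2 (boxLo_le_boxHi (boxOf e d.S)))
    exact fun i => (hz.1 i).trans (hz.2 i)
  have hincl : ∀ y ∈ boxSet (boxOf e d.W), ∀ t ∈ Icc 0 d.hD.toReal, ∀ v ∈ Icc c dd,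
      (∑ j ∈ Finset.range d.K, t ^ j • smoothTaylorMap (Ω := ⊤) hfOn j y) + t ^ d.K • v ∈ boxSet (boxOf e d.S) := by
    intro y hy t ht' v hv
    rw [mem_boxSet_iff]
    intro i
    refine mem_toNI (IntervalD.mem_of_subset (hcS (e i) (e i).isLt).2.2 ?_)
    simp only [Pi.add_apply, Finset.sum_apply, Pi.smul_apply, smul_eq_mul, ePhi]
    refine IntervalD.mem_addR d.prec (IntervalD.mem_rangeSumR d.prec d.K fun j hj => ?_) ?_
    · exact IntervalD.mem_mulR d.prec (d.mem_pows ht' (le_of_lt hj)) (hjetW y hy j (le_of_lt hj) i)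
    · exact IntervalD.mem_mulR d.prec (d.mem_pows ht' le_rfl) ⟨hv.1 i, hv.2 i⟩
  have H := highOrderEnclosure_step_smooth hf hK (S := boxSet (boxOf e d.S)) (W := boxSet (boxOf e d.W))
    (isBounded_boxSet _) (convex_boxSet _) hcd hKS hh hincl (hXW hy₀)
  obtain ⟨-, v, hv, hzt⟩ := H.2 z hz0 hz t ht
  have hzi := congrFun hzt i
  simp only [Pi.add_apply, Finset.sum_apply, Pi.smul_apply, smul_eq_mul, ePhi] at hzi
  rw [hzi]
  unfold endBoxOnI
  refine IntervalD.mem_addR d.prec (IntervalD.mem_rangeSumR d.prec d.K fun j hj => ?_) ?_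
  · exact IntervalD.mem_mulR d.prec (IntervalD.mem_powR d.prec htI j) (hjetX y₀ hy₀ j (le_of_lt hj) i)
  · exact IntervalD.mem_mulR d.prec (IntervalD.mem_powR d.prec htI d.K) ⟨hv.1 i, hv.2 i⟩

end CentreStepD

namespace RoughStepD

variable (d : RoughStepD)

/-- **The rough end-of-step box from a sub-box over a time interval**: the centre one widened by `± Ẑ₁`. [cite: KapelaZgliczynski2009, §4 Lemma 4.1; cell vocabulary, harvest/h2-tao-ladder rung1/KERNEL-CHEAP-REPLAY-SPEC.md §2 (STEP C: z_C ± D_C)] -/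
def endBoxROnI (X : Array IntervalD) (TI : IntervalD) (c : ℕ) : IntervalD :=
  ⟨(d.centre.endBoxOnI X TI c).lo.sub (dget d.Zh c), (d.centre.endBoxOnI X TI c).hi.add (dget d.Zh c)⟩

variable {ι : Type*} [Fintype ι] [DecidableEq ι] {κ : Type*} [Fintype κ]

/-- **EVERY ROUGH REALISATION'S RUN FROM THE SUB-BOX, GIVEN ON `[0, τ']`, IS IN THE INTERVAL-TIME ROUGH END BOX** at every
`t ≤ τ'` with `t ∈ TI`. [cite: KapelaZgliczynski2009, §4 Lemma 4.1; Moore1979, §8.1 eq. (8.10)] -/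
theorem end_mem_onI (e : ι ≃ Fin d.n) {Tc : κ → BTerm ι} {Tf : ℝ → κ → BTerm ι} {rows : ι → List κ}
    (hRDc : IsRTEncl e Tc Tc rows d.RD) (hRD : ∀ t ∈ Ico 0 d.hD.toReal, IsRTEncl e Tc (Tf t) rows d.RD)
    (hc : d.check = true) {X : Array IntervalD} (hwfX : ∀ c < d.n, wfD (IntervalD.aget X c) = true)
    (hXW : ∀ c < d.n, IntervalD.subset (IntervalD.aget X c) (IntervalD.aget d.W c) = true)
    {a : ι → ℝ} (ha : a ∈ boxSet (boxOf e X)) {τ' : ℝ} (hτ' : τ' ∈ Icc 0 d.hD.toReal) {Su : ℝ → ι → ℝ} (hSu0 : Su 0 = a)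
    (hSu : ∀ t ∈ Icc 0 τ', HasDerivWithinAt Su (termField (Tf t) (Su t)) (Icc 0 τ') t)
    {TI : IntervalD} {t : ℝ} (ht : t ∈ Icc 0 τ') (htI : IntervalD.mem t TI) (i : ι) :
    IntervalD.mem (Su t i) (d.endBoxROnI X TI (e i)) := by
  have hc' : d.centre.check = true ∧ d.checkKZ = true := by simpa [check, Bool.and_eq_true] using hc
  have hsub : boxSet (boxOf e X) ⊆ boxSet (boxOf e d.W) := d.boxSet_subset_of_subset e hwfX hXW
  have haW : a ∈ boxSet (boxOf e d.W) := hsub ha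
  obtain ⟨uc, hu, -, -, -, hrough⟩ := d.sound' e hRDc hRD hc
  have hdev := (hrough a haW τ' hτ' Su hSu0 hSu t ht).2 i
  have ht' : t ∈ Icc 0 d.hD.toReal := ⟨ht.1, ht.2.trans hτ'.2⟩
  have hcen : IntervalD.mem (uc a t i) (d.centre.endBoxOnI X TI (e i)) :=
    d.centre.end_mem_onI Tc e (isSQEnclosure_sqC e hRDc d.prec) hc'.1 hwfX hsub ha (hu.init a haW) (hu.hasDerivWithinAt a haW) ht' htI i
  have h1 := abs_le.1 hdev
  unfold endBoxROnI
  simp only [IntervalD.mem, Dyad.toReal_sub, Dyad.toReal_add]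
  constructor <;> linarith [hcen.1, hcen.2]

end RoughStepD

end DSSOneShift

end Summit.NavierStokesRegularity.NavierStokesRegularity.Theorems
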